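import Mathlib
import HarnessLib
import HarnessLib.Audit
import Summits.HodgeConjecture.HodgeConjecture.Statement
import Literature.AlgebraicGeometry.Motives.BettiRealization
import Literature.AlgebraicGeometry.Motives.HodgeTensor

/-!
Route: KugaSatakeDescent

CLOSED (retired) 2026-08-15T13:48:15Z by operator:999:1257524 — reason: not-a-thesis: assembly does not conclude the sub-problem Statement — note: D-0027 §2.1 audit (human 2026-08-15: routes that do not decide the summit are removed): the assembly concludes `Target`, not the sub-problem statement; a NEW conforming route may be opened from the same idea (generated `closes : … → _root_.HodgeConjecture`).. The file is kept as the record of this route; refuted decls are indexed as negative knowledge (`ledger negatives`).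

# Route KugaSatakeDescent — Kuga–Satake forgets the polarization — descent + bimodule saturation
turn KS-HC(S) and KS-HC(S') into HC(S×S') for every Hodge morphism

Realises idea card kuga-satake-descent-saturation-k3-products (spine). CONDITIONAL BRIDGE for the
regime "products of two
projective surfaces with p_g = 1 (K3, more generally h^{2,0} = 1)" of the Hodge conjecture,
conditional on the Kuga–Satake Hodge
conjecture (KS-HC) for each factor. It suffices to show X = KSDescent ∧ Saturation ∧ Transfer, three
statements about the
FULL-CLIFFORD Kuga–Satake structure KS~(T,P) := (C(T,Q_P), F¹_KS := ι(T^{2,0})·C(T,Q_P)_ℂ) of a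
polarized ℚ-Hodge structure of K3
type (Mathlib `CliffordAlgebra` of the polarization form, Literature `HodgeStructure` /
`Polarization`; KS~ ≅ KS ⊕ KS, so nothing is
lost): (D) KSDescent — KS~ is an invariant of the rational Hodge structure alone: Hodge-ISOMORPHIC
(not necessarily isometric or
similar) polarized K3-type structures have isomorphic Kuga–Satake structures; (S) Saturation — the
(End_Hdg KS~, End_Hdg KS~)-bimodule
generated by the Kuga–Satake embedding t ↦ L_{ι t} is all of Hom_Hdg(T(1), End KS~); (T) Transfer —
Varesco's left-inverse
bookkeeping run with (D)+(S) in place of his Prop 3.1, in Kleiman's operator language of a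
Betti–Hodge datum B. Then (Assembly, pure
logic, proved in the planner's Sketch.lean) the conditional theorem `Target`: for every B in which
Hodge morphisms of H¹'s are
algebraic, and all smooth projective surfaces S, S' with h^{2,0} = 1 satisfying Lefschetz (1,1) and
KS-HC (in B), EVERY morphism of
Hodge structures H²(S,ℚ) → H²(S',ℚ) is an algebraic operator (class of a codimension-2 cycle on S ×
S') — all multipliers, cross
norm-class included; with S = S': KS-HC(S) ⇒ HC(S × S). This upgrades Varesco2023 Thm 5.3 (Hodge
SIMILARITIES, rational multiplier)
to all Hodge morphisms and removes the card's parity caveat (see Saturation).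
Lean: `Saturation ∧ KSDescent ∧ Transfer`

## Assembly
Pure logic (theorem `assembly_holds` in the planner's Sketch.lean, lean check rc 0): unpack the two
KSHC witnesses of Target, feed Transfer with Saturation instantiated at (T₁,H₁,P₁) and KSDescent
instantiated at (T₁,H₁,P₁) → (T₂,H₂,P₂); the instance arguments come from the ∃-bound structures.
Codomain is the route's `Target` (a conditional HC-fragment stated in framework B), as for the other
K3-square regime routes; the passage to the summit's real carriers `HodgeTheory.HodgeConjectureFor 4
(S ⊗ S')` is the informal support item HCFragment (Künneth + Lefschetz (1,1) + the classical-datum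
bridge shared with route PeriodsPolice / definition request PeriodRealization.IsClassical), filed
after open.

CONDITIONAL on vanGeemen2000KugaSatakeHC — this route is an explicit reduction to that named conjecture (D-0019: crux floor waived).

Rationale: WHY THIS LINE. Varesco2023 (READ pp. 4, 12–16: Prop 3.1, Lemma 4.4, Thm 4.5/5.3) transfers
algebraicity through Kuga–Satake only for similarities of
RATIONAL multiplier, because his functoriality is the algebra isomorphism C⁺(λq) ≅ C⁺(q); every
other Hodge isomorphism T(S) → T(S')
between K3 surfaces has multiplier u ∈ F = End_Hdg ∩ (self-adjoint) with u ∉ ℚ (VanGeemen2008RM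
poses exactly the algebraicity of the
twist identity T_S → T_{S_a} as open, p. 13), and there C(q) ≇ C(q_u) as algebras. The card's move,
sharpened here: (D) the two Clifford
algebras are nevertheless isomorphic as ℚ-HODGE STRUCTURES, by Galois descent for representations of
G = Res_{ℚ(u)/ℚ} Spin (isomorphic
over the real field generated by the √σ(u); every equivariant iso commutes with J = f₁f₂ ∈ G(ℝ));
(S) the resulting Hodge iso f no
longer intertwines the two Kuga–Satake embeddings, but f⁻¹L_{ψt}f lands in the End_Hdg-bimodule
generated by L, whose elements are
algebraic as soon as L is (KS-HC + Lefschetz on K×K) — and the planner's representation-theoretic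
count (Zarhin1983HodgeGroupsK3 +
semisimple bimodules; NOTES.md) says the bimodule is saturated in every case (multiplicity-free, or
isotypic with pairwise anticommuting
components), not only for m even / [F:ℚ] ≤ 2 as the card feared; (T) pinning the polarization to
−cup makes Varesco's left inverse
exact: ϖ∘O = ±2^{dim T}·id by the trace form ⟨σ^*[a],[b]⟩ = −Tr(ab), so the card's risk 'e′
irrational' is gone. Imported areas:
representation theory / Galois descent of reductive ℚ-groups (spin representations, corestriction,
vanGeemen2000KugaSatakeHC §6,
VanGeemen2008RM §6), semisimple bimodule bookkeeping (Jacobson), Kleiman1968 correspondences; no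
twistor/hyperkähler geometry (unlike
routes EvenB2Twistor, NikulinTwinSimilitude, which attack the same classes unconditionally but only
for quadratic RM / multiplier 2).
Negatives index: empty at filing.

RANKED CRUXES. #0 Target (target) — CONDITIONAL THEOREM in framework B (Literature `BettiHodgeData
ℂ`: an abstract Weil cohomology W ≅ Betti with functorial polarizable Hodge structures; the intended
instance is classical singular cohomology). For every B in which every morphism of Hodge structures
H¹(K₁,ℚ) → H¹(K₂,ℚ) between smooth projective varieties is a W-algebraic operator (HOMALG: Lefschetz
(1,1) on K₁×K₂ + hard Lefschetz — a theorem classically), for all smooth projective surfaces S, S'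
with (B.hodge H²).F³ = 0 and h^{2,0} = 1, satisfying B-Lefschetz (1,1) (B.HodgeConjectureFor · 1)
and KSHC_B: there are an irreducible K3-type polarized ℚ-Hodge structure (T,H,P) and an injective
Hodge morphism j : T → H²(S) with image NS(S)^⊥ (NS := algebraicClasses S 1) and P = −(cup
pairing)∘(j×j), a smooth projective K of some dimension g and a ℚ-linear iso e : H¹(K) ≅ C(T,Q_P)
with (B.hodge H¹K).F² = 0 and e_ℂ(F¹H¹(K)) = F¹_KS := ι_ℂ(T^{2,0})·C_ℂ (K is a full-Clifford
Kuga–Satake variety of S, ≅ KS(S)^{2^ρ+1} up to isogeny), and a ℚ-linear O : H²(S) → H^{2g}(K×K),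
O(NS) = 0, O(j t) the PURE class inducing e⁻¹∘L_{ι t}∘e on H¹(K) (and 0 on Hⁱ(K), i ≠ 1) in
Kleiman's sense (W.IsInducedBy g g), which is an algebraic operator (W.IsAlgebraicOperator 2 (g+g)
O) — this is the Kuga–Satake Hodge conjecture vanGeemen2000KugaSatakeHC 10.2 / Huybrechts2016K3 Ch.4
Conj.2.11 in operator form — and the same for S': THEN every φ : Hom (B.hodge H²(S)) (B.hodge
H²(S')) has W.IsAlgebraicOperator 2 2 φ (class of a codimension-2 cycle on S×S'). All multipliers; S
= S' allowed (KS-HC(S) ⇒ HC(S×S)). (why it might fail: For the classical datum this is 'KS-HC(S) ∧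
KS-HC(S′) ⇒ Hom_Hdg(H²S, H²S′) algebraic': it fails only if HC fails on some product of two
KS-algebraic p_g=1 surfaces; known just for Hodge similarities of rational multiplier (Varesco2023
Thm 5.3) and CM/isometries (Buskin2019).) [vanGeemen2000KugaSatakeHC, Varesco2023, Huybrechts2016K3,
Kleiman1968, Buskin2019]
#2 Saturation (crux) — SATURATION (card item Q2 (S), full-Clifford form; ranked first as the most
informative node — it decides the card's 'parity Question C'). For every finite-dimensional
irreducible polarized ℚ-Hodge structure of K3 type (T,H,P) (H.F 3 = ⊥, h^{2,0} = 1, no nonzero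
rational vector in F¹) put C := CliffordAlgebra Q_P (Q_P v = P.form v v), F¹_KS := ι_ℂ(T^{2,0})·C_ℂ
⊂ ℂ⊗C, 𝔅 := End_Hdg(KS~) = {b ∈ End_ℚ C : b_ℂ F¹_KS ⊆ F¹_KS}, and M := Hom_Hdg(T(1), End KS~) = {μ :
T →ₗ End_ℚ C : μ_ℂ(ω)(C_ℂ) ⊆ F¹_KS and μ_ℂ(ω)(F¹_KS) = 0 for ω ∈ T^{2,0}; μ_ℂ(w)(F¹_KS) ⊆ F¹_KS for
w ∈ F¹T}. CLAIM: M is the ℚ-span of the maps t ↦ b ∘ L_{ι t} ∘ b′ with b, b′ ∈ 𝔅 (the bimodule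
generated by the Kuga–Satake embedding κ = L∘ι saturates M). Planner's expectation (NOTES.md §Sat
analysis): TRUE in all cases — over ℚ̄, with G = Res Spin_F (Zarhin1983HodgeGroupsK3: Hdg(T) =
Res_{F/ℚ}SO_F or Res U_E, and MT(KS~) = its full preimage · G_m), M is multiplicity-free (RM with m
= dim_F T even; CM) so N = M because every isotypic component of L is nonzero, or M ≅ End(U)^{[F:ℚ]}
isotypic (RM, m odd) and the [F:ℚ] components A_σ of L are pairwise ANTICOMMUTING units (W_σ ⊥ W_τ ⇒
L_{w_σ}L_{w_τ} = −L_{w_τ}L_{w_σ}, γ_σ and γ_τ commute), hence linearly independent, hence generate —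
the card's n ≤ 2 restriction (via Varesco's √d) is an artefact of working in C⁺ with κ(v) = L_v
R_{v₀}. This item is where that sketch becomes a proof or breaks. [difficulty: L] (why it might
fail: Presumes Hdg(T) Zarhin-maximal and MT(KS~) its full preimage, and a clean sign bookkeeping of
L on the graded tensor product ⊗̂C(W_σ); a slip there, or a K3-type T escaping Zarhin's hypotheses,
leaves N ⊊ M — first suspect: [F:ℚ] = 3, m = 3 (VanGeemen2008RM §5, Galluzzi2000).)
[Zarhin1983HodgeGroupsK3, VanGeemen2008RM, vanGeemen2000KugaSatakeHC, Varesco2023, Galluzzi2000]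
#3 Transfer (crux) — TRANSFER (card item Q3 (T); pointwise; Varesco2023 §4 with descent+saturation
in place of his Prop 3.1/Lemma 3.5). Same B, S, S′ and hypotheses as Target, but with the
Kuga–Satake data (T_i,H_i,P_i,j_i,K_i,e_i,O_i) as explicit ∀-binders, plus (a) the saturation
conclusion for (T₁,H₁,P₁) and (b) the descent conclusion T₁ ⇝ T₂ (every BIJECTIVE Hodge morphism ψ :
H₁ → H₂ gives F : C(P₁) ≃ₗ[ℚ] C(P₂) with F_ℂ(F¹_KS) = F¹_KS): THEN every Hodge morphism φ : H²(S) →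
H²(S′) is an algebraic operator. Proof plan: φ maps NS to NS′ (Hodge classes; Lefschetz (1,1) twice,
cup of pull-backs of algebraic classes) and T₁ → NS′ trivially (irreducible); ψ := φ|_T is 0 or
bijective onto T′; f := e₂⁻¹∘F∘e₁ : H¹K₁ ≅ H¹K₂ is a Hodge iso, algebraic with its inverse (HOMALG);
μ(t) := (e₁ f⁻¹e₂⁻¹)·L_{ι(ψt)}·(e₂ f e₁⁻¹) ∈ M₁ = N₁ by (a), so t ↦ [L_{ι ψ t}] ∈ H^{2g₂}(K₂×K₂) is
an algebraic operator (𝔅₁-elements are Hodge endomorphisms of H¹K₁, algebraic by HOMALG; [a] ↦ [b a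
b′] and conjugation by algebraic isos are algebraic operators; O₁ algebraic by KS-HC(S)); finally
the left inverse ϖ := O₂^† ∘ σ^* (Poincaré transposes, σ = swap of K₂×K₂) satisfies ⟨σ^*[a],[b]⟩ =
−Tr(a∘b) and Tr(L_tL_{t′}) = 2^{dim T₂}·P₂(t,t′) = −2^{dim T₂}(t·t′), so ϖ∘O₂ = ±2^{dim T₂}·id on T′
EXACTLY (P pinned to −cup) and φ|_T = ±2^{−dim T₂} ϖ∘(t ↦ [L_{ιψt}]) is algebraic. Only Sat for the
SOURCE and no irrational e′ (card's Q3 risk removed). [deps: Saturation, KSDescent] [difficulty: L]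
(why it might fail: Operator calculus over an abstract Weil theory: needs [a] ↦ [b a b′],
conjugation by algebraic isos and O₂^†σ^* to be algebraic operators with the tree's IsInducedBy
normalisation, and the exact identity ⟨σ^*[a],[b]⟩ = ±Tr(ab); a sign/purity slip forces a restate, a
real gap kills the line.) [Varesco2023, Kleiman1968, vanGeemen2000KugaSatakeHC, Buskin2019,
Lieberman1968]
#4 KSDescent (crux) — DESCENT (card item Q1 (D), functorial full-Clifford form: 'Kuga–Satake forgets
the polarization'). For every finite-dimensional irreducible polarized K3-type (T,H,P) and every
polarized (T′,H′,P′) with a BIJECTIVE Hodge morphism ψ : H → H′ (any multiplier: ψ*P′ = P(u·,·) with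
u ∈ F totally positive, u ∉ ℚ allowed), there is a ℚ-linear isomorphism F : C(T,Q_P) ≃ C(T′,Q_{P′})
with F_ℂ(F¹_KS(H,P)) = F¹_KS(H′,P′) — an isomorphism of the Kuga–Satake ℚ-Hodge structures (NOT an
algebra map: C(q) ≇ C(q_u) in general). Corollaries: KS(T,q) ∼ KS(T,q_u) for all totally positive u
∈ F; Kuga–Satake varieties of Hodge-isogenous K3 surfaces are isogenous (by an algebraic class,
Lefschetz on K×K′). Proof plan: reduce to T′ = T; u := P⁻¹P′ ∈ E = End_Hdg(T) is P-self-adjoint with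
positive real spectrum, F′ := ℚ(u) is a totally real FIELD (E is a division algebra since T is
irreducible), T is F′-free with q = tr Φ′, q′ = tr uΦ′; over the real field L = F′^{gal}(√σ(u) : σ)
the isometry ⊕_σ √σ(u) induces an L-algebra iso C(q′)_L ≅ C(q)_L that is equivariant for G :=
Res_{F′/ℚ}Spin_{F′}(Φ′) → Spin(q), Spin(q′) (Spin_{F′}(uΦ′) = Spin_{F′}(Φ′) canonically, vw ↦
u⁻¹vw); representations of G isomorphic over L are isomorphic over ℚ (Hom_G ⊗ L = Hom_{G_L}, det ≢ 0
over an infinite field); any G-equivariant ℚ-iso commutes with J = f₁f₂ ∈ G(ℝ), which corresponds to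
J_u = f₁′f₂′, hence carries the L_J-eigenspace F¹_KS = ω·C_ℂ to F¹_KS. [difficulty: L] (why it might
fail: Hinges on the ℚ-form of Res_{ℚ(u)/ℚ}Spin → Spin(q), Spin(q_u) and Galois descent of its
representations (μ₂-kernels; ℚ(u) a field only by irreducibility); CM case implicit in
Vangeemen2001, RM case unrecorded — an obstruction caps the route at rational multipliers
(Varesco2023).) [Varesco2023, VanGeemen2008RM, vanGeemen2000KugaSatakeHC, Vangeemen2001,
arXiv:math/0609839]
#9 KSWellDefined (support) — SANITY / non-vacuity, provable now: for polarized K3-type (T,H,P) (H.F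
3 = ⊥, h^{2,0} = 1) the subspace F¹_KS := ι_ℂ(T^{2,0})·C_ℂ and its complex conjugate are
complementary in ℂ ⊗ C(T,Q_P) and 2·dim_ℂ F¹_KS = dim_ℚ C — i.e. (C, F¹_KS) is a genuine weight-one
Hodge structure (`HodgeStructure.ofSplitting`), the full-Clifford Kuga–Satake structure. Proof: ω² =
Q(ω) = 0 and ωω̄ + ω̄ω = 2P_ℂ(ω,ω̄) ≠ 0 (Hodge–Riemann) give C_ℂ = ωC_ℂ ⊕ ω̄C_ℂ
(vanGeemen2000KugaSatakeHC 5.5–5.7; Huybrechts2016K3 Ch.4 §2.1). [difficulty: provable-now]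
[vanGeemen2000KugaSatakeHC, Huybrechts2016K3]
#9 KSEmbeddingHodge (support) — SANITY / non-vacuity of Saturation's hypothesis class, provable now:
the Kuga–Satake embedding itself, μ₀ := t ↦ L_{ι t} (`(LinearMap.mul ℚ C).comp (CliffordAlgebra.ι
Q_P)`), satisfies the Hodge conditions defining M: for ω ∈ T^{2,0}, ω·C_ℂ ⊆ F¹_KS and ω·F¹_KS =
ω²·C_ℂ = 0; for w ∈ F¹T = (T^{2,0})^{⊥_P} ⊕ …, w·ω = −ω·w (P_ℂ(w,ω) = 0 by the first Hodge–Riemann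
relation `Polarization.form_apply_eq_zero`), so w·F¹_KS ⊆ F¹_KS. This is the tree-level form of
'T(1) ↪ End(KS) is a morphism of Hodge structures' (vanGeemen2000KugaSatakeHC Prop 6.3;
Huybrechts2016K3 Ch.4 Prop 2.6). [difficulty: provable-now] [vanGeemen2000KugaSatakeHC,
Huybrechts2016K3]

TWO-LAYER PLAN. Foreseen glued splits (none filed now): Saturation ⇐ ZarhinMT (Hodge/Mumford–Tate
group of an irreducible polarized K3-type structure
is Res_{F/ℚ}SO_F(Φ) resp. Res U_E, and MT of KS~ is its full spin preimage · G_m;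
Zarhin1983HodgeGroupsK3 Thm 2.2.1/2.3.1, to be vendored as a
Literature fact) → SatAlgebraic (the Hodge-free statement: for (T,q,F) the 𝔤_F-equivariant maps T →
End C lie in the bimodule generated
by L over the commutant of the corestriction subalgebra; multiplicity count + anticommuting units) →
Saturation. KSDescent ⇐
PolarizationsDiffer (P′ = P(u·,·), u ∈ E self-adjoint totally positive, ℚ(u) totally real field, T
free, q = tr Φ′) → RepDescent
(G-representations C(q), C(q_u) isomorphic over ℚ with an F¹-preserving iso) → KSDescent. Transfer ⇐
OperatorCalculus (in B: [a] ↦ [b a b′],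
conjugation by algebraic isomorphisms, transposes and the swap are algebraic operators; ⟨σ^*[a],[b]⟩
= ±Tr(ab)) → TraceIdentity
(Tr(L_tL_{t′}) = 2^{dim T} P(t,t′)) → Transfer.

KILL CRITERIA. (i) A K3-type (T,H,P) with N ⊊ M — e.g. an exact kit computation of dim M and dim N
for van Geemen's [F:ℚ] = 3, m = 3 lattice
(VanGeemen2008RM §5; C = C(ℚ⁹, tr Φ), dim C = 512) — refutes Saturation; the route survives only if
the failure is confined to a locus
avoidable by restating (then restate Saturation with the extra hypothesis and keep Target for that
class), else close
refuted:Saturation. (ii) Two polarizations of one irreducible K3-type T with non-isomorphic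
Kuga–Satake ℚ-Hodge structures (a CM example
from Vangeemen2001, or End(KS) computations à la VanGeemen2008RM §5.7 showing KS(T,q) ≁ KS(T,q_u))
refutes KSDescent and caps the line at
rational multipliers = Varesco2023: close refuted:KSDescent. (iii) An operator-calculus obstruction
in Transfer that is not a
normalisation slip. (iv) HC(S×S′) proved for all K3 pairs by another route (twistor transport,
EvenB2Twistor/NikulinTwinSimilitude
generalised) moots the bridge; a disproof of KS-HC makes it vacuous.

NOT DECOMPOSED YET. Zarhin's theorem and the Mumford–Tate group of KS~ (layer-2 child of
Saturation); the algebraic-group plumbing of Res_{ℚ(u)/ℚ}Spin and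
Galois descent (children of KSDescent); the correspondence lemmas in B (children of Transfer, or
prover lemmas via --supports); the
passage framework B → real carriers (HCFragment, informal support) and the K3 notion (definition
request IsK3Surface exists; not needed:
statements are for all surfaces with h^{2,0} = 1); the census of pairs where KS-HC is known on both
sides (informal support
CrossClassCensus); the hyperkähler version (Varesco2023 Thm 4.5 needs Lefschetz in degree 2) — out
of scope.

CHEAPEST FALSIFIER. ONE exact linear-algebra computation (kit, ℚ or F_p with p ≡ 1 mod 8 so that √2,
√(σu) exist): F = ℚ(√2), Φ = diag(√2−1, √2−1, −1) twisted
to signature (2−,4+) as in VanGeemen2008RM §5, T = ℚ⁶, q = tr Φ, u = 3+√2 (N(u) = 7, cross-class):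
with 𝔤 = so_F(Φ) ⊂ so(q) lifted to
C(q) (dim 64) compute dim End_𝔤(C) (expected 4·(2·2)² … i.e. dim End(U) with U = U_{σ₁} ⊗ U_{σ₂},
dim U_σ = 4: 256), dim M = dim
Hom_𝔤(T ⊗ C, C) (expected 2·256 = 512) and dim N = dim span{b L b′} (expected 512 = dim M); then dim
Hom_𝔤(C(q_u), C(q)) (expected 256,
containing an invertible element). Any other numbers refute Saturation resp. KSDescent as analysed.
Second: the [F:ℚ] = 3, m = 3
example (dim C = 512). I could not run kit this session (planner seat; lit/galaxy partly down) —
refuters first.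

NUMBERS. KS-HC (Huybrechts2016K3 Ch.4 Conj.2.11: surfaces with h^{2,0} = 1) is known for: abelian
surfaces and Kummer surfaces / K3 surfaces
isogenous to an abelian surface (Morrison; Moonen–Zarhin HC for powers of abelian surfaces;
Huybrechts2016K3 Ch.4 Rem.3.2, §3.2), Paranjape's
double planes branched in six lines (Huybrechts2016K3 Ch.4 §3.3), the ρ = 16 quartic/double-sextic
families of Schlickewei2010 and
van Geemen–ILP (Varesco2025), the countably many 4-dimensional families with T ≅ T(K)(2), K a
generalized-Kummer sixfold (Floccari2024,
via Varesco–Voisin / Voisin footnotes for Kum^n). Real multiplication needs m = dim_F T ≥ 3, so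
[F:ℚ] ≤ 7 and rank T = 3[F:ℚ] … ≤ 21;
first RM case beyond Varesco2023: [F:ℚ] = 2, u ∉ ℚ·(F^×)² (cross-class), and [F:ℚ] = 3
(VanGeemen2008RM §5, Galluzzi2000). Items at open:
7 typed (target, assembly, 3 cruxes, 2 supports) + 2 informal supports.

DEFINITION REQUESTS. None blocking — every statement is typed over existing declarations (Mathlib
CliffordAlgebra; Literature HodgeStructure, Polarization,
homBaseChange, BettiHodgeData, PreWeilCohomology.IsInducedBy / IsAlgebraicOperator). Linked, not
required: defn-HodgeStructure.kugaSatake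
(the even-Clifford KS structure with API; would shorten every statement),
defn-PeriodRealization.IsClassical (pins B to the classical
datum; needed by the informal support HCFragment), defn-IsK3Surface. Cite fact wanted:
Zarhin1983HodgeGroupsK3 Thm 2.2.1/2.3.1 (Hodge group of an
irreducible polarized K3-type structure) as a Literature named fact for the Saturation prover.

Novelty: Searches (2026-08-15): `lit search --source zbmath "Kuga-Satake variety real multiplication K3
surface"` (2: VanGeemen2008RM, Moonen 2017);
`… "Kuga-Satake Hodge conjecture algebraic correspondence"` (8: Voisin footnotes 2022, IIK 2025
Hodge-standard for K3², Varesco2025,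
Schlickewei 2009/2010, …); `… "Kuga-Satake abelian variety isogeny class polarization"` (0); `…
"Kuga-Satake half twist CM type"` (1: van
Geemen–Izadi 2002); `… "Kuga-Satake variety" --year-from 1995` (33: Rizov, Varesco–Voisin 2022,
Voisin 2005 generalisation, Madapusi Pera,
Kurnosov–Soldatenkov–Verbitsky, Schreieder–Soldatenkov, Lombardo2001, Galluzzi2000, Kreutz–Shen–Vial
dRB, McAndrew Galois descent for K3
motives, Floccari–Fu 2026 OG6, …); `lit galaxy search "Kuga-Satake variety" --star all` (5 books:
Huybrechts K3, Cattani et al., Kerr–Pearlstein,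
Tretkoff, Chudnovsky) and `--in-book` Huybrechts2016K3 Ch.4 (READ §§2.1–3.3: Example 2.4 direct
sums, Cl⁺ ∼ Cl⁻, Rem 2.7 v₀-independence,
Conj 2.11, known cases — no statement comparing KS for two polarizations); `lit galaxy search
"Kuga-Satake Hodge conjecture" --star all` (0);
local searchd/openalex/arxiv/s2 unavailable (rc reset / 429). READ: Varesco2023 pp. 4, 7, 12–16 (Def
1.2 λ ∈ ℚ; Prop 3.1 = algebra iso
C⁺(λq) ≅ C⁺(q); Lemma 4.4 φ = λ·Id by HR + deformation; Thm 4.5/5.3); vanGeemen2000KugaSatakeHC pp.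
7–11, 16 (5.5–6.6, 10.2); card audit
(refuter r17: Vangeemen2001 Thm 3.10 makes (D) implicit in the CM case).
Nearest prior art found: Varesco2023 = doi  [refs: 10.1007/s00209-023-03390-8, math/0609839, doi:10.1007/s00209-023-03390-8, Varesco2025, Lombardo2001, Varesco2023]

Barriers (technique_class: kuga-satake, galois-descent, conditional-bridge): - technique_class: kuga-satake, galois-descent, conditional-bridge
- Literature.Barriers.HodgeConjecture.Andre1996_hodgeClassesOnAbelianVarieties_motivated:
consistent, not evaded — the route proves no Hodge class on an abelian variety algebraic; it
composes the ASSUMED Kuga–Satake–Deligne class (KS-HC) with endomorphisms/isogenies of abelian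
varieties (Lefschetz (1,1) on K×K′, hypothesis HOMALG) and shows the target classes lie in the
algebra they generate (Saturation); André's 'motivated' is exactly what KS-HC would upgrade to
'algebraic'.
- Literature.Barriers.HodgeConjecture.hodgeClassesAreAbsoluteFor_abelianVariety: same remark;
absoluteness of κ_X (Huybrechts2016K3 Ch.4 Rem 4.6) is not used.
- Literature.Barriers.HodgeConjecture.Weil1977_exceptionalHodgeClasses: the classes reached
(real-multiplication and cross-class Hodge morphisms in T(S)^∨ ⊗ T(S′)) are exceptional (outside NS
⊗ NS′ and outside the algebra generated by similarities); they are reached through the Kuga–Satake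
side, where they become products of KNOWN algebraic operators — the bet is precisely that no
Weil-type residue survives saturation (Schlickewei2010 needed one without it).
- Literature.Barriers.HodgeConjecture.Mumford1968_simpleFourfold_exceptionalHodgeClasses:
Mumford-type fourfolds appear as KS factors for [F:ℚ] = 3, m = 3 (Galluzzi2000); the route never
needs THEIR exceptional classes, only End(K) and κ — this is what the [F:ℚ] = 3 kit check probes.
- Literature.Barriers.HodgeConjecture.Zucker1

History (route lifecycle, newest last):
- 2026-08-15T13:48:15Z · CLOSED retired — not-a-thesis: assembly does not conclude the sub-problem Statement (operator:999:1257524)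

sub-problem: HodgeConjecture · status: closed(retired) · opened planner-plancard-HodgeConjecture-HodgeConject-e33a2133-0 2026-08-15T12:03:49Z · rev 2 · ledger route-HodgeConjecture-KugaSatakeDescent
GENERATED by the gate from the ledger (D-0016/17). Provers cite these decls: `theorem foo : Summit.HodgeConjecture.HodgeConjecture.Theses.KugaSatakeDescent.<Decl> := …` in Summits/HodgeConjecture/HodgeConjecture/Theorems/<Name>.lean.
-/

namespace Summit.HodgeConjecture.HodgeConjecture.Theses.KugaSatakeDescent

open scoped BigOperators Topology Manifold Classical MeasureTheory ProbabilityTheory Matrix InnerProductSpace ComplexConjugate ContinuousMap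
open Filter Set Function TopologicalSpace MeasureTheory

attribute [summit_statement] _root_.HodgeConjecture
-- H21.Audit: conditional_on 'vanGeemen2000KugaSatakeHC' is not an accepted declaration — no route_premise tag

/-- item stmt-HodgeConjecture-7132 · target · rank 0 · closed · moot by None · by planner
why it might fail: Classically: KS-HC(S)∧KS-HC(S′) ⇒ Hom_Hdg(H²S,H²S′) algebraic; false only if HC fails on such a product. Known: isometries (Buskin2019, Huybrechts2019), similarities λ∈ℚ under KS-HC (Varesco2023 Thm 5.3); open for RM multipliers u∉ℚ (VanGeemen2008RM p.13) — there Saturation's isotypic case decides.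
sources: vanGeemen2000KugaSatakeHC, Varesco2023, Buskin2019, Huybrechts2019, VanGeemen2008RM, Huybrechts2016K3
[target] CONDITIONAL THEOREM in framework B (Literature `BettiHodgeData ℂ`: an abstract Weil
cohomology W ≅ Betti with functorial polarizable Hodge structures; the intended instance is
classical singular cohomology). For every B in which every morphism of Hodge structures H¹(K₁,ℚ) →
H¹(K₂,ℚ) between smooth projective varieties is a W-algebraic operator (HOMALG: Lefschetz (1,1) on
K₁×K₂ + hard Lefschetz — a theorem classically), for all smooth projective surfaces S, S' with
(B.hodge H²).F³ = 0 and h^{2,0} = 1, satisfying B-Lefschetz (1,1) (B.HodgeConjectureFor · 1) and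
KSHC_B: there are an irreducible K3-type polarized ℚ-Hodge structure (T,H,P) and an injective Hodge
morphism j : T → H²(S) with image NS(S)^⊥ (NS := algebraicClasses S 1) and P = −(cup pairing)∘(j×j),
a smooth projective K of some dimension g and a ℚ-linear iso e : H¹(K) ≅ C(T,Q_P) with (B.hodge
H¹K).F² = 0 and e_ℂ(F¹H¹(K)) = F¹_KS := ι_ℂ(T^{2,0})·C_ℂ (K is a full-Clifford Kuga–Satake variety
of S, ≅ KS(S)^{2^ρ+1} up to isogeny), and a ℚ-linear O : H²(S) → H^{2g}(K×K), O(NS) = 0, O(j t) the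
PURE class inducing e⁻¹∘L_{ι t}∘e on H¹(K) (and 0 on Hⁱ(K), i ≠ 1) in Kleiman's sense (W.IsInducedBy
g g), which is an algebraic -/
@[route_item "route-HodgeConjecture-KugaSatakeDescent"]
def Target : Prop :=
  open Literature.AlgebraicGeometry.Motives CategoryTheory.MonoidalCategory in ∀ (B : BettiHodgeData ℂ), (∀ ⦃m n : ℕ⦄ ⦃X Y : SchemeOver ℂ⦄ (hX : IsSmoothProjective m X) (hY : IsSmoothProjective n Y) (ψ : (B.hodge hX 1).Hom (B.hodge hY 1)), B.W.IsAlgebraicOperator m n ψ.toLinearMap) → ∀ (S S' : SchemeOver ℂ) (hS : IsSmoothProjective 2 S) (hS' : IsSmoothProjective 2 S'), ((B.hodge hS 2).F 3 = ⊥ ∧ (B.hodge hS 2).hodgeNumber 2 0 = 1) → ((B.hodge hS' 2).F 3 = ⊥ ∧ (B.hodge hS' 2).hodgeNumber 2 0 = 1) → B.HodgeConjectureFor hS 1 → B.HodgeConjectureFor hS' 1 → (∃ (T : Type) (_ : AddCommGroup T) (_ : Module ℚ T) (_ : Module.Finite ℚ T) (H : HodgeStructure T 2) (P : H.Polarization)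 (j : H.Hom (B.hodge hS 2)), (H.F 3 = ⊥ ∧ H.hodgeNumber 2 0 = 1 ∧ (∀ t : T, HodgeStructure.ofRat t ∈ H.F 1 → t = 0)) ∧ (Function.Injective j.toLinearMap ∧ LinearMap.range j.toLinearMap = LinearMap.BilinForm.orthogonal (B.W.cupPairing S 2 2 2 rfl) (B.W.algebraicClasses S 1) ∧ P.form = -(B.W.cupPairing S 2 2 2 rfl).compl₁₂ j.toLinearMap j.toLinearMap) ∧ ∃ (g : ℕ) (K : SchemeOver ℂ) (hK : IsSmoothProjective g K) (e : B.W.obj K 1 ≃ₗ[ℚ] CliffordAlgebra (LinearMap.BilinMap.toQuadraticMap P.form)) (j₁ : ℕ) (hj : 1 + j₁ = 2 * g) (hm : 1 + 2 * g + j₁ = 2 * (g + g)) (O : B.W.obj S 2 →ₗ[ℚ] B.W.obj (K ⊗ K) (2 * g)), (B.hodge hK 1).F 2 = ⊥ ∧ ((B.hodge hK 1).F 1).map (e.toLinearMap.baseChange ℂ) = (Submodule.map ((CliffordAlgebra.ι (LinearMap.BilinMap.toQuadraticMap P.form)).baseChange ℂ) (H.piece 2 0) * ⊤) ∧ (∀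 t, B.W.IsInducedBy g g (O (j.toLinearMap t)) (e.symm.toLinearMap ∘ₗ LinearMap.mulLeft ℚ ((CliffordAlgebra.ι (LinearMap.BilinMap.toQuadraticMap P.form)) t) ∘ₗ e.toLinearMap) hj hm) ∧ (∀ t (i k : ℕ), i ≠ 1 → ∀ (hik : i + k = 2 * g) (him : i + 2 * g + k = 2 * (g + g)), B.W.IsInducedBy g g (O (j.toLinearMap t)) (0 : Module.End ℚ (B.W.obj K i)) hik him) ∧ (∀ d ∈ B.W.algebraicClasses S 1, O d = 0) ∧ B.W.IsAlgebraicOperator 2 (g + g) O) → (∃ (T : Type) (_ : AddCommGroup T) (_ : Module ℚ T) (_ : Module.Finite ℚ T) (H : HodgeStructure T 2) (P : H.Polarization) (j : H.Hom (B.hodge hS' 2)), (H.F 3 = ⊥ ∧ H.hodgeNumber 2 0 = 1 ∧ (∀ t : T, HodgeStructure.ofRat t ∈ H.F 1 → t = 0)) ∧ (Function.Injective j.toLinearMap ∧ LinearMap.range j.toLinearMap = LinearMap.BilinForm.orthogonal (B.W.cupPairing S' 2 2 2 rfl) (B.W.algebraicClasses S' 1) ∧ P.form = -(B.W.cupPairing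 S' 2 2 2 rfl).compl₁₂ j.toLinearMap j.toLinearMap) ∧ ∃ (g : ℕ) (K : SchemeOver ℂ) (hK : IsSmoothProjective g K) (e : B.W.obj K 1 ≃ₗ[ℚ] CliffordAlgebra (LinearMap.BilinMap.toQuadraticMap P.form)) (j₁ : ℕ) (hj : 1 + j₁ = 2 * g) (hm : 1 + 2 * g + j₁ = 2 * (g + g)) (O : B.W.obj S' 2 →ₗ[ℚ] B.W.obj (K ⊗ K) (2 * g)), (B.hodge hK 1).F 2 = ⊥ ∧ ((B.hodge hK 1).F 1).map (e.toLinearMap.baseChange ℂ) = (Submodule.map ((CliffordAlgebra.ι (LinearMap.BilinMap.toQuadraticMap P.form)).baseChange ℂ) (H.piece 2 0) * ⊤) ∧ (∀ t, B.W.IsInducedBy g g (O (j.toLinearMap t)) (e.symm.toLinearMap ∘ₗ LinearMap.mulLeft ℚ ((CliffordAlgebra.ι (LinearMap.BilinMap.toQuadraticMap P.form)) t) ∘ₗ e.toLinearMap) hj hm) ∧ (∀ t (i k : ℕ), i ≠ 1 → ∀ (hik : i + k = 2 * g) (him : i + 2 * g + k = 2 * (g + g)), B.W.IsInducedBy g g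 (O (j.toLinearMap t)) (0 : Module.End ℚ (B.W.obj K i)) hik him) ∧ (∀ d ∈ B.W.algebraicClasses S' 1, O d = 0) ∧ B.W.IsAlgebraicOperator 2 (g + g) O) → ∀ φ : (B.hodge hS 2).Hom (B.hodge hS' 2), B.W.IsAlgebraicOperator 2 2 φ.toLinearMap

/-- item stmt-HodgeConjecture-7133 · crux · rank 2 · closed · moot by None · by planner
why it might fail: Unpublished: N=M needs every κ-block to have full rank dim Hom_G(T,Hom(U_i,U_j)) — paper-checked only (RM m odd rests on anticommuting units; first suspects (n,m)=(2,3),(3,3)); typed for ALL dim T with no Zarhin hypothesis, so a proof must re-derive Hdg(T)=SO_E/U_E.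
sources: Zarhin1983HodgeGroupsK3, VanGeemen2008RM, vanGeemen2000KugaSatakeHC, Varesco2023, Galluzzi2000, Literature.AlgebraicGeometry.Motives.HodgeStructure.Zarhin1983_hodgeGroup_eq
[crux] SATURATION (card item Q2 (S), full-Clifford form; ranked first as the most informative node —
it decides the card's 'parity Question C'). For every finite-dimensional irreducible polarized
ℚ-Hodge structure of K3 type (T,H,P) (H.F 3 = ⊥, h^{2,0} = 1, no nonzero rational vector in F¹) put
C := CliffordAlgebra Q_P (Q_P v = P.form v v), F¹_KS := ι_ℂ(T^{2,0})·C_ℂ ⊂ ℂ⊗C, 𝔅 := End_Hdg(KS~) =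
{b ∈ End_ℚ C : b_ℂ F¹_KS ⊆ F¹_KS}, and M := Hom_Hdg(T(1), End KS~) = {μ : T →ₗ End_ℚ C : μ_ℂ(ω)(C_ℂ)
⊆ F¹_KS and μ_ℂ(ω)(F¹_KS) = 0 for ω ∈ T^{2,0}; μ_ℂ(w)(F¹_KS) ⊆ F¹_KS for w ∈ F¹T}. CLAIM: M is the
ℚ-span of the maps t ↦ b ∘ L_{ι t} ∘ b′ with b, b′ ∈ 𝔅 (the bimodule generated by the Kuga–Satake
embedding κ = L∘ι saturates M). Planner's expectation (NOTES.md §Sat analysis): TRUE in all cases —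
over ℚ̄, with G = Res Spin_F (Zarhin1983HodgeGroupsK3: Hdg(T) = Res_{F/ℚ}SO_F or Res U_E, and
MT(KS~) = its full preimage · G_m), M is multiplicity-free (RM with m = dim_F T even; CM) so N = M
because every isotypic component of L is nonzero, or M ≅ End(U)^{[F:ℚ]} isotypic (RM, m odd) and the
[F:ℚ] components A_σ of L are pairwise ANTICOMMUTING units (W_σ ⊥ W_τ ⇒ L_{w_σ}L_{w_τ} =
−L_{w_τ}L_{w_σ}, γ_σ an -/
@[route_item "route-HodgeConjecture-KugaSatakeDescent"]
def Saturation : Prop :=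
  open Literature.AlgebraicGeometry.Motives in ∀ (T : Type) [AddCommGroup T] [Module ℚ T] [Module.Finite ℚ T] (H : HodgeStructure T 2) (P : H.Polarization), H.F 3 = ⊥ → H.hodgeNumber 2 0 = 1 → (∀ t : T, HodgeStructure.ofRat t ∈ H.F 1 → t = 0) → ∀ μ : T →ₗ[ℚ] Module.End ℚ (CliffordAlgebra (LinearMap.BilinMap.toQuadraticMap P.form)), (∀ w ∈ H.F 1, let g := HodgeStructure.homBaseChange _ _ (μ.baseChange ℂ w); (Submodule.map ((CliffordAlgebra.ι (LinearMap.BilinMap.toQuadraticMap P.form)).baseChange ℂ) (H.piece 2 0) * ⊤).map g ≤ (Submodule.map ((CliffordAlgebra.ι (LinearMap.BilinMap.toQuadraticMap P.form)).baseChange ℂ) (H.piece 2 0) * ⊤) ∧ (w ∈ H.piece 2 0 → LinearMap.range g ≤ (Submodule.map ((CliffordAlgebra.ι (LinearMap.BilinMap.toQuadraticMap P.form)).baseChange ℂ) (H.piece 2 0) * ⊤) ∧ (Submodule.map ((CliffordAlgebra.ι (LinearMap.BilinMap.toQuadraticMap P.form)).baseChange ℂ) (H.piece 2 0) * ⊤).map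 g = ⊥)) → μ ∈ Submodule.span ℚ {ν : T →ₗ[ℚ] Module.End ℚ (CliffordAlgebra (LinearMap.BilinMap.toQuadraticMap P.form)) | ∃ b b' : Module.End ℚ (CliffordAlgebra (LinearMap.BilinMap.toQuadraticMap P.form)), (Submodule.map ((CliffordAlgebra.ι (LinearMap.BilinMap.toQuadraticMap P.form)).baseChange ℂ) (H.piece 2 0) * ⊤).map (b.baseChange ℂ) ≤ (Submodule.map ((CliffordAlgebra.ι (LinearMap.BilinMap.toQuadraticMap P.form)).baseChange ℂ) (H.piece 2 0) * ⊤) ∧ (Submodule.map ((CliffordAlgebra.ι (LinearMap.BilinMap.toQuadraticMap P.form)).baseChange ℂ) (H.piece 2 0) * ⊤).map (b'.baseChange ℂ) ≤ (Submodule.map ((CliffordAlgebra.ι (LinearMap.BilinMap.toQuadraticMap P.form)).baseChange ℂ) (H.piece 2 0) * ⊤) ∧ ∀ t, ν t = b ∘ₗ LinearMap.mulLeft ℚ ((CliffordAlgebra.ι (LinearMap.BilinMap.toQuadraticMap P.form)) t) ∘ₗ b'}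

/-- item stmt-HodgeConjecture-7134 · support · rank 3 · closed · moot by None · by planner
why it might fail: Operator calculus over an abstract Weil theory: needs [a] ↦ [b a b′], conjugation by algebraic isos and O₂^†σ^* to be algebraic operators with the tree's IsInducedBy normalisation, and the exact identity ⟨σ^*[a],[b]⟩ = ±Tr(ab); a sign/purity slip forces a restate, a real gap kills the line.
sources: Varesco2023, Kleiman1968, Lieberman1968, vanGeemen2000KugaSatakeHC
[crux] TRANSFER (card item Q3 (T); pointwise; Varesco2023 §4 with descent+saturation in place of his
Prop 3.1/Lemma 3.5). Same B, S, S′ and hypotheses as Target, but with the Kuga–Satake data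
(T_i,H_i,P_i,j_i,K_i,e_i,O_i) as explicit ∀-binders, plus (a) the saturation conclusion for
(T₁,H₁,P₁) and (b) the descent conclusion T₁ ⇝ T₂ (every BIJECTIVE Hodge morphism ψ : H₁ → H₂ gives
F : C(P₁) ≃ₗ[ℚ] C(P₂) with F_ℂ(F¹_KS) = F¹_KS): THEN every Hodge morphism φ : H²(S) → H²(S′) is an
algebraic operator. Proof plan: φ maps NS to NS′ (Hodge classes; Lefschetz (1,1) twice, cup of
pull-backs of algebraic classes) and T₁ → NS′ trivially (irreducible); ψ := φ|_T is 0 or bijective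
onto T′; f := e₂⁻¹∘F∘e₁ : H¹K₁ ≅ H¹K₂ is a Hodge iso, algebraic with its inverse (HOMALG); μ(t) :=
(e₁ f⁻¹e₂⁻¹)·L_{ι(ψt)}·(e₂ f e₁⁻¹) ∈ M₁ = N₁ by (a), so t ↦ [L_{ι ψ t}] ∈ H^{2g₂}(K₂×K₂) is an
algebraic operator (𝔅₁-elements are Hodge endomorphisms of H¹K₁, algebraic by HOMALG; [a] ↦ [b a b′]
and conjugation by algebraic isos are algebraic operators; O₁ algebraic by KS-HC(S)); finally the
left inverse ϖ := O₂^† ∘ σ^* (Poincaré transposes, σ = swap of K₂×K₂) satisfies ⟨σ^*[a],[b]⟩ =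
−Tr(a∘b) and Tr(L_tL_{t′}) = 2^{dim -/
@[route_item "route-HodgeConjecture-KugaSatakeDescent"]
def Transfer : Prop :=
  open Literature.AlgebraicGeometry.Motives CategoryTheory.MonoidalCategory in ∀ (B : BettiHodgeData ℂ), (∀ ⦃m n : ℕ⦄ ⦃X Y : SchemeOver ℂ⦄ (hX : IsSmoothProjective m X) (hY : IsSmoothProjective n Y) (ψ : (B.hodge hX 1).Hom (B.hodge hY 1)), B.W.IsAlgebraicOperator m n ψ.toLinearMap) → ∀ (S S' : SchemeOver ℂ) (hS : IsSmoothProjective 2 S) (hS' : IsSmoothProjective 2 S'), ((B.hodge hS 2).F 3 = ⊥ ∧ (B.hodge hS 2).hodgeNumber 2 0 = 1) → ((B.hodge hS' 2).F 3 = ⊥ ∧ (B.hodge hS' 2).hodgeNumber 2 0 = 1) → B.HodgeConjectureFor hS 1 → B.HodgeConjectureFor hS' 1 → ∀ (T₁ : Type) [AddCommGroup T₁] [Module ℚ T₁] [Module.Finite ℚ T₁] (H₁ : HodgeStructure T₁ 2) (P₁ : H₁.Polarization) (j₁ : H₁.Hom (B.hodge hS 2)), let Q₁ := LinearMap.BilinMap.toQuadraticMap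 P₁.form; let F₁ := Submodule.map ((CliffordAlgebra.ι Q₁).baseChange ℂ) (H₁.piece 2 0) * ⊤; (H₁.F 3 = ⊥ ∧ H₁.hodgeNumber 2 0 = 1 ∧ (∀ t : T₁, HodgeStructure.ofRat t ∈ H₁.F 1 → t = 0)) → (Function.Injective j₁.toLinearMap ∧ LinearMap.range j₁.toLinearMap = LinearMap.BilinForm.orthogonal (B.W.cupPairing S 2 2 2 rfl) (B.W.algebraicClasses S 1) ∧ P₁.form = -(B.W.cupPairing S 2 2 2 rfl).compl₁₂ j₁.toLinearMap j₁.toLinearMap) → ∀ (g₁ : ℕ) (K₁ : SchemeOver ℂ) (hK₁ : IsSmoothProjective g₁ K₁) (e₁ : B.W.obj K₁ 1 ≃ₗ[ℚ] CliffordAlgebra Q₁) (i₁ : ℕ) (hj₁ : 1 + i₁ = 2 * g₁) (hm₁ : 1 + 2 * g₁ + i₁ = 2 * (g₁ + g₁)) (O₁ : B.W.obj S 2 →ₗ[ℚ] B.W.obj (K₁ ⊗ K₁) (2 * g₁)), ((B.hodge hK₁ 1).F 2 = ⊥ ∧ ((B.hodge hK₁ 1).F 1).map (e₁.toLinearMap.baseChange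 ℂ) = F₁ ∧ (∀ t, B.W.IsInducedBy g₁ g₁ (O₁ (j₁.toLinearMap t)) (e₁.symm.toLinearMap ∘ₗ LinearMap.mulLeft ℚ ((CliffordAlgebra.ι Q₁) t) ∘ₗ e₁.toLinearMap) hj₁ hm₁) ∧ (∀ t (i k : ℕ), i ≠ 1 → ∀ (hik : i + k = 2 * g₁) (him : i + 2 * g₁ + k = 2 * (g₁ + g₁)), B.W.IsInducedBy g₁ g₁ (O₁ (j₁.toLinearMap t)) (0 : Module.End ℚ (B.W.obj K₁ i)) hik him) ∧ (∀ d ∈ B.W.algebraicClasses S 1, O₁ d = 0) ∧ B.W.IsAlgebraicOperator 2 (g₁ + g₁) O₁) → ∀ (T₂ : Type) [AddCommGroup T₂] [Module ℚ T₂] [Module.Finite ℚ T₂] (H₂ : HodgeStructure T₂ 2) (P₂ : H₂.Polarization) (j₂ : H₂.Hom (B.hodge hS' 2)), let Q₂ := LinearMap.BilinMap.toQuadraticMap P₂.form; let F₂ := Submodule.map ((CliffordAlgebra.ι Q₂).baseChange ℂ) (H₂.piece 2 0) * ⊤; (H₂.F 3 = ⊥ ∧ H₂.hodgeNumber 2 0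 = 1 ∧ (∀ t : T₂, HodgeStructure.ofRat t ∈ H₂.F 1 → t = 0)) → (Function.Injective j₂.toLinearMap ∧ LinearMap.range j₂.toLinearMap = LinearMap.BilinForm.orthogonal (B.W.cupPairing S' 2 2 2 rfl) (B.W.algebraicClasses S' 1) ∧ P₂.form = -(B.W.cupPairing S' 2 2 2 rfl).compl₁₂ j₂.toLinearMap j₂.toLinearMap) → ∀ (g₂ : ℕ) (K₂ : SchemeOver ℂ) (hK₂ : IsSmoothProjective g₂ K₂) (e₂ : B.W.obj K₂ 1 ≃ₗ[ℚ] CliffordAlgebra Q₂) (i₂ : ℕ) (hj₂ : 1 + i₂ = 2 * g₂) (hm₂ : 1 + 2 * g₂ + i₂ = 2 * (g₂ + g₂)) (O₂ : B.W.obj S' 2 →ₗ[ℚ] B.W.obj (K₂ ⊗ K₂) (2 * g₂)), ((B.hodge hK₂ 1).F 2 = ⊥ ∧ ((B.hodge hK₂ 1).F 1).map (e₂.toLinearMap.baseChange ℂ) = F₂ ∧ (∀ t, B.W.IsInducedBy g₂ g₂ (O₂ (j₂.toLinearMap t)) (e₂.symm.toLinearMap ∘ₗ LinearMap.mulLeft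 ℚ ((CliffordAlgebra.ι Q₂) t) ∘ₗ e₂.toLinearMap) hj₂ hm₂) ∧ (∀ t (i k : ℕ), i ≠ 1 → ∀ (hik : i + k = 2 * g₂) (him : i + 2 * g₂ + k = 2 * (g₂ + g₂)), B.W.IsInducedBy g₂ g₂ (O₂ (j₂.toLinearMap t)) (0 : Module.End ℚ (B.W.obj K₂ i)) hik him) ∧ (∀ d ∈ B.W.algebraicClasses S' 1, O₂ d = 0) ∧ B.W.IsAlgebraicOperator 2 (g₂ + g₂) O₂) → (∀ μ : T₁ →ₗ[ℚ] Module.End ℚ (CliffordAlgebra Q₁), (∀ w ∈ H₁.F 1, let g := HodgeStructure.homBaseChange _ _ (μ.baseChange ℂ w); F₁.map g ≤ F₁ ∧ (w ∈ H₁.piece 2 0 → LinearMap.range g ≤ F₁ ∧ F₁.map g = ⊥)) → μ ∈ Submodule.span ℚ {ν : T₁ →ₗ[ℚ] Module.End ℚ (CliffordAlgebra Q₁) | ∃ b b' : Module.End ℚ (CliffordAlgebra Q₁), F₁.map (b.baseChange ℂ) ≤ F₁ ∧ F₁.map (b'.baseChange ℂ) ≤ F₁ ∧ ∀ t, ν t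 = b ∘ₗ LinearMap.mulLeft ℚ ((CliffordAlgebra.ι Q₁) t) ∘ₗ b'}) → (∀ ψ : H₁.Hom H₂, Function.Bijective ψ.toLinearMap → ∃ F : CliffordAlgebra Q₁ ≃ₗ[ℚ] CliffordAlgebra Q₂, F₁.map (F.toLinearMap.baseChange ℂ) = F₂) → ∀ φ : (B.hodge hS 2).Hom (B.hodge hS' 2), B.W.IsAlgebraicOperator 2 2 φ.toLinearMap

/-- item stmt-HodgeConjecture-7135 · support · rank 4 · closed · moot by None · by planner
why it might fail: Hinges on the ℚ-form of Res_{ℚ(u)/ℚ}Spin → Spin(q), Spin(q_u) and Galois descent of its representations (μ₂-kernels; ℚ(u) a field only by irreducibility); CM case implicit in Vangeemen2001, RM case unrecorded — an obstruction caps the route at rational multipliers (Varesco2023).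
sources: VanGeemen2008RM, Huybrechts2016K3, vanGeemen2000KugaSatakeHC, Vangeemen2001, Varesco2023
[crux] DESCENT (card item Q1 (D), functorial full-Clifford form: 'Kuga–Satake forgets the
polarization'). For every finite-dimensional irreducible polarized K3-type (T,H,P) and every
polarized (T′,H′,P′) with a BIJECTIVE Hodge morphism ψ : H → H′ (any multiplier: ψ*P′ = P(u·,·) with
u ∈ F totally positive, u ∉ ℚ allowed), there is a ℚ-linear isomorphism F : C(T,Q_P) ≃ C(T′,Q_{P′})
with F_ℂ(F¹_KS(H,P)) = F¹_KS(H′,P′) — an isomorphism of the Kuga–Satake ℚ-Hodge structures (NOT an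
algebra map: C(q) ≇ C(q_u) in general). Corollaries: KS(T,q) ∼ KS(T,q_u) for all totally positive u
∈ F; Kuga–Satake varieties of Hodge-isogenous K3 surfaces are isogenous (by an algebraic class,
Lefschetz on K×K′). Proof plan: reduce to T′ = T; u := P⁻¹P′ ∈ E = End_Hdg(T) is P-self-adjoint with
positive real spectrum, F′ := ℚ(u) is a totally real FIELD (E is a division algebra since T is
irreducible), T is F′-free with q = tr Φ′, q′ = tr uΦ′; over the real field L = F′^{gal}(√σ(u) : σ)
the isometry ⊕_σ √σ(u) induces an L-algebra iso C(q′)_L ≅ C(q)_L that is equivariant for G :=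
Res_{F′/ℚ}Spin_{F′}(Φ′) → Spin(q), Spin(q′) (Spin_{F′}(uΦ′) = Spin_{F′}(Φ′) canonically, vw ↦
u⁻¹vw); representations of G isomorph -/
@[route_item "route-HodgeConjecture-KugaSatakeDescent"]
def KSDescent : Prop :=
  open Literature.AlgebraicGeometry.Motives in ∀ (T : Type) [AddCommGroup T] [Module ℚ T] [Module.Finite ℚ T] (T' : Type) [AddCommGroup T'] [Module ℚ T'] [Module.Finite ℚ T'] (H : HodgeStructure T 2) (H' : HodgeStructure T' 2) (P : H.Polarization) (P' : H'.Polarization), H.F 3 = ⊥ → H.hodgeNumber 2 0 = 1 → (∀ t : T, HodgeStructure.ofRat t ∈ H.F 1 → t = 0) → ∀ ψ : H.Hom H', Function.Bijective ψ.toLinearMap → ∃ F : CliffordAlgebra (LinearMap.BilinMap.toQuadraticMap P.form) ≃ₗ[ℚ] CliffordAlgebra (LinearMap.BilinMap.toQuadraticMap P'.form), (Submodule.map ((CliffordAlgebra.ι (LinearMap.BilinMap.toQuadraticMap P.form)).baseChange ℂ) (H.piece 2 0) * ⊤).map (F.toLinearMap.baseChange ℂ) = (Submodule.map ((CliffordAlgebra.ι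 (LinearMap.BilinMap.toQuadraticMap P'.form)).baseChange ℂ) (H'.piece 2 0) * ⊤)

/-- item stmt-HodgeConjecture-7136 · support · rank 9 · closed · moot by None · by planner
sources: vanGeemen2000KugaSatakeHC, Huybrechts2016K3
[support] SANITY / non-vacuity, provable now: for polarized K3-type (T,H,P) (H.F 3 = ⊥, h^{2,0} = 1)
the subspace F¹_KS := ι_ℂ(T^{2,0})·C_ℂ and its complex conjugate are complementary in ℂ ⊗ C(T,Q_P)
and 2·dim_ℂ F¹_KS = dim_ℚ C — i.e. (C, F¹_KS) is a genuine weight-one Hodge structure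
(`HodgeStructure.ofSplitting`), the full-Clifford Kuga–Satake structure. Proof: ω² = Q(ω) = 0 and
ωω̄ + ω̄ω = 2P_ℂ(ω,ω̄) ≠ 0 (Hodge–Riemann) give C_ℂ = ωC_ℂ ⊕ ω̄C_ℂ (vanGeemen2000KugaSatakeHC
5.5–5.7; Huybrechts2016K3 Ch.4 §2.1). [difficulty: provable-now] -/
@[route_item "route-HodgeConjecture-KugaSatakeDescent"]
def KSWellDefined : Prop :=
  open Literature.AlgebraicGeometry.Motives in ∀ (T : Type) [AddCommGroup T] [Module ℚ T] [Module.Finite ℚ T] (H : HodgeStructure T 2) (P : H.Polarization), H.F 3 = ⊥ → H.hodgeNumber 2 0 = 1 → IsCompl (Submodule.map ((CliffordAlgebra.ι (LinearMap.BilinMap.toQuadraticMap P.form)).baseChange ℂ) (H.piece 2 0) * ⊤) (HodgeStructure.complexConj (Submodule.map ((CliffordAlgebra.ι (LinearMap.BilinMap.toQuadraticMap P.form)).baseChange ℂ) (H.piece 2 0) * ⊤)) ∧ 2 * Module.finrank ℂ ↥(Submodule.map ((CliffordAlgebra.ι (LinearMap.BilinMap.toQuadraticMap P.form)).baseChange ℂ)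 (H.piece 2 0) * ⊤) = Module.finrank ℚ (CliffordAlgebra (LinearMap.BilinMap.toQuadraticMap P.form))

/-- item stmt-HodgeConjecture-7137 · support · rank 9 · closed · moot by None · by planner
sources: vanGeemen2000KugaSatakeHC, Huybrechts2016K3
[support] SANITY / non-vacuity of Saturation's hypothesis class, provable now: the Kuga–Satake
embedding itself, μ₀ := t ↦ L_{ι t} (`(LinearMap.mul ℚ C).comp (CliffordAlgebra.ι Q_P)`), satisfies
the Hodge conditions defining M: for ω ∈ T^{2,0}, ω·C_ℂ ⊆ F¹_KS and ω·F¹_KS = ω²·C_ℂ = 0; for w ∈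
F¹T = (T^{2,0})^{⊥_P} ⊕ …, w·ω = −ω·w (P_ℂ(w,ω) = 0 by the first Hodge–Riemann relation
`Polarization.form_apply_eq_zero`), so w·F¹_KS ⊆ F¹_KS. This is the tree-level form of 'T(1) ↪
End(KS) is a morphism of Hodge structures' (vanGeemen2000KugaSatakeHC Prop 6.3; Huybrechts2016K3
Ch.4 Prop 2.6). [difficulty: provable-now] -/
@[route_item "route-HodgeConjecture-KugaSatakeDescent"]
def KSEmbeddingHodge : Prop :=
  open Literature.AlgebraicGeometry.Motives in ∀ (T : Type) [AddCommGroup T] [Module ℚ T] [Module.Finite ℚ T] (H : HodgeStructure T 2) (P : H.Polarization), H.F 3 = ⊥ → H.hodgeNumber 2 0 = 1 → ∀ w ∈ H.F 1, let g := HodgeStructure.homBaseChange _ _ ((((LinearMap.mul ℚ (CliffordAlgebra (LinearMap.BilinMap.toQuadraticMap P.form))).comp (CliffordAlgebra.ι (LinearMap.BilinMap.toQuadraticMap P.form)))).baseChange ℂ w); (Submodule.map ((CliffordAlgebra.ι (LinearMap.BilinMap.toQuadraticMap P.form)).baseChange ℂ) (H.piece 2 0) * ⊤).map g ≤ (Submodule.map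 ((CliffordAlgebra.ι (LinearMap.BilinMap.toQuadraticMap P.form)).baseChange ℂ) (H.piece 2 0) * ⊤) ∧ (w ∈ H.piece 2 0 → LinearMap.range g ≤ (Submodule.map ((CliffordAlgebra.ι (LinearMap.BilinMap.toQuadraticMap P.form)).baseChange ℂ) (H.piece 2 0) * ⊤) ∧ (Submodule.map ((CliffordAlgebra.ι (LinearMap.BilinMap.toQuadraticMap P.form)).baseChange ℂ) (H.piece 2 0) * ⊤).map g = ⊥)

-- item stmt-HodgeConjecture-7456 · support · rank 9 · closed · moot by None · by planner — informal only, no Lean statement yet: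
--   [support] CROSS-CLASS CENSUS (card item Q5; documentation/computation, no Lean statement intended):
--   list the UNCONDITIONAL theorems the bridge yields today, i.e. pairs (S,S′) of smooth projective
--   surfaces with p_g = 1 such that (a) KS-HC is KNOWN for both — abelian and Kummer surfaces / K3
--   isogenous to an abelian surface (Moonen–Zarhin; Huybrechts2016K3 Ch.4 Rem.3.2, §3.2), Paranjape's
--   double planes in six lines (Huybrechts2016K3 Ch.4 §3.3), the ρ = 16 families of Schlickewei2010 and
--   van Geemen–Ingalls–Logan–Patashnick (Varesco2025), the countably many 4-dimensional families with
--   T(S) ≅ T(K)(2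

-- item stmt-HodgeConjecture-7459 · support · rank 9 · closed · moot by None · by planner — informal only, no Lean statement yet:
--   [support] HC-FRAGMENT BRIDGE (framework B → the summit's real carriers; informal until the
--   classical-datum predicate lands — definition request defn-PeriodRealization.IsClassical, shared with
--   route PeriodsPolice item ClassicalBridge). For the CLASSICAL Betti–Hodge datum B₀ : BettiHodgeData ℂ
--   (singular cohomology of complex points with its true Hodge structures, cup product, trace and cycle
--   classes): (i) HOMALG(B₀) holds — every morphism of Hodge structures H¹(X,ℚ) → H¹(Y,ℚ) between smooth
--   projective X, Y is an algebraic operator (its class in H^{2n_X−1}(X)⊗H¹(Y) is (L^{n_X−1}⊗1) of a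
--   Hodge cla

/-- item stmt-HodgeConjecture-7138 · assembly · rank 1 · closed · moot by None · by planner
sources: Varesco2023, vanGeemen2000KugaSatakeHC
[assembly] Saturation → KSDescent → Transfer → Target (pure logic). -/
@[route_item "route-HodgeConjecture-KugaSatakeDescent"]
def Assembly : Prop :=
  Saturation → KSDescent → Transfer → Target

end Summit.HodgeConjecture.HodgeConjecture.Theses.KugaSatakeDescent
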